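import Mathlib
import HarnessLib

/-!
# Variation of parameters on a right half-line with data at `+∞`:
# the particular solution `y₁ ∫_x^∞ y₂ φ − y₂ ∫_x^∞ y₁ φ` of `y″ = p y′ + q y + W φ`

Topic `Literature/Analysis/ODE` (namespace `Literature.Analysis.ODE`). Elementary tool of asymptotic
integration at `+∞` (construction of solutions with prescribed asymptotic expansion at an irregular
singular point by successive / a-posteriori correction: Coddington–Levinson Ch. 3 §8, Olver Ch. 7 §2;
Hartman Ch. X §17). Given two classical solutions `y₁, y₂` of the homogeneous linear equation
`y″ = p y′ + q y` on `(X, ∞)` (`𝕜 = ℝ` or `ℂ`) and a continuous weight `φ` with `y₁ φ`, `y₂ φ`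
integrable on `(X, ∞)`, the function

  `e(x) = y₁(x) ∫_{(x,∞)} y₂ φ − y₂(x) ∫_{(x,∞)} y₁ φ`

is twice differentiable on `(X, ∞)` with `e′ = y₁′ ∫ y₂ φ − y₂′ ∫ y₁ φ` (the boundary terms cancel) and
`e″ = p e′ + q e + W φ`, `W = y₁ y₂′ − y₁′ y₂` (`hasDerivAt_varParams_Ioi`). With `φ = h/W` this is THE
particular solution of `y″ = p y′ + q y + h` that is small at `+∞` when `h` is; its size is read off from
the tails (`norm_setIntegral_Ioi_le_of_norm_le_rpow`: `‖∫_{(x,∞)} k‖ ≤ C x^{1−q}/(q − 1)` when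
`‖k(t)‖ ≤ C t^{−q}`, `q > 1`).

Also: the fundamental theorem of calculus for right tails of a function continuous and integrable on an
open half-line (`hasDerivAt_setIntegral_Ioi_of_continuousOn`; the whole-line version is
`hasDerivAt_integral_Ioi_of_integrableOn` of `OutgoingVariationOfParameters.lean`), and integrability
from a power bound (`integrableOn_Ioi_of_norm_le_rpow_neg`). Everything is proved; folklore.

## References
* E. A. Coddington, N. Levinson, *Theory of Ordinary Differential Equations* (1955), Ch. 3 §§6, 8.
  [CoddingtonLevinson1955]
* P. Hartman, *Ordinary Differential Equations*, SIAM Classics 38 (2002), Ch. IV §8 (variation of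
  constants), Ch. X §17. [Hartman2002]
-/

noncomputable section

open Set MeasureTheory Filter intervalIntegral
open scoped Topology

namespace Literature.Analysis.ODE

/-! ### Right tails: derivative, integrability, size -/

section Tails

variable {E : Type*} [NormedAddCommGroup E] [NormedSpace ℝ E] [CompleteSpace E]

/-- FTC for right tails on an open half-line: if `k` is continuous and integrable on `(X, ∞)` then
`d/dx ∫_{(x,∞)} k = −k(x)` at every `x > X`. [folklore] -/
theorem hasDerivAt_setIntegral_Ioi_of_continuousOn {k : ℝ → E} {X r : ℝ} (hk : ContinuousOn k (Ioi X))
    (hki : IntegrableOn k (Ioi X)) (hr : X < r) :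
    HasDerivAt (fun z => ∫ t in Ioi z, k t) (-k r) r := by
  set a : ℝ := (X + r) / 2 with ha_def
  have hXa : X < a := by rw [ha_def]; linarith
  have har : a < r := by rw [ha_def]; linarith
  have hev : (fun z => ∫ t in Ioi z, k t) =ᶠ[𝓝 r] fun z => (∫ t in Ioi a, k t) - ∫ t in a..z, k t := by
    filter_upwards [Ioi_mem_nhds har] with z hz
    have hz' : X < z := hXa.trans hz
    rw [← integral_Ioi_sub_Ioi' (hki.mono_set (Ioi_subset_Ioi hXa.le)) (hki.mono_set (Ioi_subset_Ioi hz'.le)),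
      sub_sub_cancel]
  refine HasDerivAt.congr_of_eventuallyEq ?_ hev
  have hint : IntervalIntegrable k volume a r :=
    (hk.mono fun t ht => hXa.trans_le ht.1).intervalIntegrable_of_Icc har.le
  have hmeas : StronglyMeasurableAtFilter k (𝓝 r) volume :=
    hk.stronglyMeasurableAtFilter isOpen_Ioi r hr
  have hcont : ContinuousAt k r := hk.continuousAt (Ioi_mem_nhds hr)
  exact (integral_hasDerivAt_right hint hmeas hcont).const_sub (∫ t in Ioi a, k t)

omit [NormedSpace ℝ E] [CompleteSpace E] in
/-- A function continuous on `(X, ∞)` (`X > 0`) with `‖k(t)‖ ≤ C t^{−q}`, `q > 1`, is integrable on `(X, ∞)`.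
[folklore] -/
theorem integrableOn_Ioi_of_norm_le_rpow_neg {k : ℝ → E} {X C q : ℝ} (hX : 0 < X) (hq : 1 < q)
    (hk : ContinuousOn k (Ioi X)) (hb : ∀ t, X < t → ‖k t‖ ≤ C * t ^ (-q)) : IntegrableOn k (Ioi X) := by
  have hg : IntegrableOn (fun t : ℝ => C * t ^ (-q)) (Ioi X) :=
    ((integrableOn_Ioi_rpow_of_lt (by linarith) hX).const_mul C)
  refine Integrable.mono' hg (hk.aestronglyMeasurable measurableSet_Ioi) ?_
  exact (ae_restrict_iff' measurableSet_Ioi).2 (Eventually.of_forall fun t ht => hb t ht)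

omit [CompleteSpace E] in
/-- SIZE OF A RIGHT TAIL: if `‖k(t)‖ ≤ C t^{−q}` on `(X, ∞)` (`X > 0`, `q > 1`), then for every `x ≥ X`,
`‖∫_{(x,∞)} k‖ ≤ C x^{1−q}/(q − 1)`. [folklore] -/
theorem norm_setIntegral_Ioi_le_of_norm_le_rpow {k : ℝ → E} {X C q : ℝ} (hX : 0 < X) (hq : 1 < q)
    (hb : ∀ t, X < t → ‖k t‖ ≤ C * t ^ (-q)) {x : ℝ} (hx : X ≤ x) :
    ‖∫ t in Ioi x, k t‖ ≤ C / (q - 1) * x ^ (1 - q) := by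
  have hx0 : 0 < x := hX.trans_le hx
  have hg : IntegrableOn (fun t : ℝ => C * t ^ (-q)) (Ioi x) :=
    ((integrableOn_Ioi_rpow_of_lt (by linarith) hx0).const_mul C)
  have hle : ∀ᵐ t ∂(volume.restrict (Ioi x)), ‖k t‖ ≤ C * t ^ (-q) :=
    (ae_restrict_iff' measurableSet_Ioi).2 (Eventually.of_forall fun t ht => hb t (hx.trans_lt ht))
  calc ‖∫ t in Ioi x, k t‖ ≤ ∫ t in Ioi x, C * t ^ (-q) := norm_integral_le_of_norm_le hg hle
    _ = C * (-x ^ (-q + 1) / (-q + 1)) := by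
        rw [MeasureTheory.integral_const_mul, integral_Ioi_rpow_of_lt (by linarith) hx0]
    _ = C / (q - 1) * x ^ (1 - q) := by
        have hq1 : (-q + 1) ≠ 0 := by linarith
        have hq2 : (q - 1) ≠ 0 := by linarith
        rw [show (1 - q) = (-q + 1) by ring]
        field_simp
        ring

end Tails

/-! ### The particular solution with data at `+∞` -/

/-- **VARIATION OF PARAMETERS WITH TAILS.** Let `y₁, y₂` solve `y″ = p y′ + q y` classically on `(X, ∞)`
and let `φ` be continuous there with `y₁ φ`, `y₂ φ` integrable on `(X, ∞)`. Then
`e = y₁ ∫_{(·,∞)} y₂ φ − y₂ ∫_{(·,∞)} y₁ φ` has, at every `x > X`, derivative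
`e′ = y₁′ ∫ y₂ φ − y₂′ ∫ y₁ φ`, and `e′` has derivative `p e′ + q e + (y₁ y₂′ − y₁′ y₂) φ`: with
`φ = h/W` (`W` the Wronskian) `e` solves `e″ = p e′ + q e + h`.
[cite: Hartman2002, Ch. IV §8 (variation of constants)] -/
theorem hasDerivAt_varParams_Ioi {𝕜 : Type*} [RCLike 𝕜] {p q φ y₁ y₂ y₁' y₂' : ℝ → 𝕜} {X : ℝ}
    (h1 : ∀ t ∈ Ioi X, HasDerivAt y₁ (y₁' t) t ∧ HasDerivAt y₁' (p t * y₁' t + q t * y₁ t) t)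
    (h2 : ∀ t ∈ Ioi X, HasDerivAt y₂ (y₂' t) t ∧ HasDerivAt y₂' (p t * y₂' t + q t * y₂ t) t)
    (hφ : ContinuousOn φ (Ioi X)) (hi1 : IntegrableOn (fun t => y₁ t * φ t) (Ioi X))
    (hi2 : IntegrableOn (fun t => y₂ t * φ t) (Ioi X)) {x : ℝ} (hx : X < x) :
    HasDerivAt (fun z => y₁ z * (∫ t in Ioi z, y₂ t * φ t) - y₂ z * ∫ t in Ioi z, y₁ t * φ t)
        (y₁' x * (∫ t in Ioi x, y₂ t * φ t) - y₂' x * ∫ t in Ioi x, y₁ t * φ t) x ∧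
      HasDerivAt (fun z => y₁' z * (∫ t in Ioi z, y₂ t * φ t) - y₂' z * ∫ t in Ioi z, y₁ t * φ t)
        (p x * (y₁' x * (∫ t in Ioi x, y₂ t * φ t) - y₂' x * ∫ t in Ioi x, y₁ t * φ t) +
          q x * (y₁ x * (∫ t in Ioi x, y₂ t * φ t) - y₂ x * ∫ t in Ioi x, y₁ t * φ t) +
          (y₁ x * y₂' x - y₁' x * y₂ x) * φ x) x := by
  have hc1 : ContinuousOn y₁ (Ioi X) := fun t ht => (h1 t ht).1.continuousAt.continuousWithinAt
  have hc2 : ContinuousOn y₂ (Ioi X) := fun t ht => (h2 t ht).1.continuousAt.continuousWithinAt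
  have hI1 : HasDerivAt (fun z => ∫ t in Ioi z, y₁ t * φ t) (-(y₁ x * φ x)) x :=
    hasDerivAt_setIntegral_Ioi_of_continuousOn (hc1.mul hφ) hi1 hx
  have hI2 : HasDerivAt (fun z => ∫ t in Ioi z, y₂ t * φ t) (-(y₂ x * φ x)) x :=
    hasDerivAt_setIntegral_Ioi_of_continuousOn (hc2.mul hφ) hi2 hx
  obtain ⟨hd1, hd1'⟩ := h1 x hx
  obtain ⟨hd2, hd2'⟩ := h2 x hx
  constructor
  · refine ((hd1.mul hI2).sub (hd2.mul hI1)).congr_deriv ?_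
    ring
  · refine ((hd1'.mul hI2).sub (hd2'.mul hI1)).congr_deriv ?_
    ring

/-- The same, as a solution "on `(X, ∞)`" in the format `∀ t ∈ Ioi X, HasDerivAt e (e′ t) t ∧ HasDerivAt e′ (…) t`
with named `e`, `e′`. [cite: Hartman2002, Ch. IV §8 (variation of constants)] -/
theorem varParams_Ioi_solution {𝕜 : Type*} [RCLike 𝕜] {p q φ y₁ y₂ y₁' y₂' : ℝ → 𝕜} {X : ℝ}
    (h1 : ∀ t ∈ Ioi X, HasDerivAt y₁ (y₁' t) t ∧ HasDerivAt y₁' (p t * y₁' t + q t * y₁ t) t)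
    (h2 : ∀ t ∈ Ioi X, HasDerivAt y₂ (y₂' t) t ∧ HasDerivAt y₂' (p t * y₂' t + q t * y₂ t) t)
    (hφ : ContinuousOn φ (Ioi X)) (hi1 : IntegrableOn (fun t => y₁ t * φ t) (Ioi X))
    (hi2 : IntegrableOn (fun t => y₂ t * φ t) (Ioi X)) :
    ∃ e e' : ℝ → 𝕜, (∀ x, e x = y₁ x * (∫ t in Ioi x, y₂ t * φ t) - y₂ x * ∫ t in Ioi x, y₁ t * φ t) ∧
      (∀ x, e' x = y₁' x * (∫ t in Ioi x, y₂ t * φ t) - y₂' x * ∫ t in Ioi x, y₁ t * φ t) ∧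
      ∀ x ∈ Ioi X, HasDerivAt e (e' x) x ∧
        HasDerivAt e' (p x * e' x + q x * e x + (y₁ x * y₂' x - y₁' x * y₂ x) * φ x) x :=
  ⟨_, _, fun _ => rfl, fun _ => rfl, fun _ hx => hasDerivAt_varParams_Ioi h1 h2 hφ hi1 hi2 hx⟩

end Literature.Analysis.ODE

end
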